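import Mathlib.Algebra.Field.ZMod
import Literature.Barriers.ValiantsHypothesis.CharacteristicTwo
import Literature.Computability.AlgebraicComplexity.DetInVP
import HarnessLib

/-!
# Barrier `ValiantsHypothesis/CharacteristicTwo`: the class form `CharacteristicFreePerNotVP`
is REFUTED outright (Bürgisser–Clausen–Shokrollahi 1997, Rem. (21.16)(1))

Sibling proofs file of `CharacteristicTwo.lean` (barrier catalogue entry `PermanentCharTwo`,
"`PER = DET` in characteristic two"). That file defines the TECHNIQUE CLASS (class form)

* `CharacteristicFreePerNotVP : Prop := ∀ (k : Type) [Field k], ¬ IsVPFamily fun n => perPoly (Fin n) k`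

("the permanent family is not in `VP` over any field", the conclusion a field-independent
argument would deliver) and refutes it CONDITIONALLY on the tree fact `DET ∈ VP` over `𝔽₂`
(`not_characteristicFreePerNotVP (hdet : isVPFamily_detPoly (ZMod 2))`), recording that
conditionality in the `scope_caveats` clause of `PermanentCharTwo`.

`CharacteristicFreePerNotVP` is NOT a fact to be discharged: read as a proposition it is FALSE,
so no `CharacteristicFreePerNotVP_holds` can exist. The source prints exactly its failure in
characteristic two — "PER = DET, if char `k = 2`. Hence `PER ∈ VP` in characteristic 2, see
Example (21.6)(4)" (Rem. (21.16)(1), p. 576 of the held copy), with "(4) `DET := (DET_n)_{n ≥ 1}`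
… The fact that `DET ∈ VP` follows by Gaussian elimination" (Ex. (21.6)(4), p. 573). The tree
now PROVES `DET ∈ VP` over every commutative ring
(`Literature.Computability.AlgebraicComplexity.isVPFamily_detPoly_of_commRing`, Berkowitz's
division-free algorithm, `DetInVP.lean`; the fact `isVPFamily_detPoly` is discharged there by
`isVPFamily_detPoly_holds`), so the hypothesis `hdet` is supplied and everything becomes
unconditional here:

* `isVPFamily_perPoly_of_charTwo_of_commRing` — `PER ∈ VP` over every commutative ring of
  characteristic `2`;
* `isVPFamily_perPoly_of_charTwo'` — `PER ∈ VP` over every field of characteristic `2`;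
* `characteristicFreePerNotVP_false : ¬ CharacteristicFreePerNotVP` — the refutation;
* `exists_field_isVPFamily_perPoly` — the positive witness form (`k = 𝔽₂`).

This supersedes the conditionality recorded in `PermanentCharTwo`'s `scope_caveats`. Nothing is
claimed about `VP ≠ VNP` itself in characteristic `2` (open), only about the PERMANENT there.

## References

* [BurgisserClausenShokrollahi1997] P. Bürgisser, M. Clausen, M. A. Shokrollahi, *Algebraic
  Complexity Theory*, Grundlehren 315, Springer 1997: Ex. (21.6)(4) (`DET ∈ VP`), Rem. (21.16)(1)
  (`PER = DET` and `PER ∈ VP` in characteristic `2`), Thm. (21.17), (21.19).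
-/

noncomputable section

namespace Literature.Barriers.ValiantsHypothesis

open Literature.Computability.AlgebraicComplexity MvPolynomial

/-- **`PER ∈ VP` in characteristic two, over every commutative ring** of characteristic `2`
(in particular over every field of characteristic `2`): `PER_n = DET_n` there
(`perPoly_eq_detPoly_of_charP_two`) and `DET ∈ VP` by a division-free polynomial-size circuit
(tree: `isVPFamily_detPoly_of_commRing`). "Hence `PER ∈ VP` in characteristic 2."
[cite: BurgisserClausenShokrollahi1997, Rem. (21.16)(1) and Ex. (21.6)(4)] -/
theorem isVPFamily_perPoly_of_charTwo_of_commRing (k : Type*) [CommRing k] [CharP k 2] :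
    IsVPFamily fun n => perPoly (Fin n) k := by
  have : (fun n => perPoly (Fin n) k) = fun n => detPoly (Fin n) k :=
    funext fun n => perPoly_eq_detPoly_of_charP_two
  rw [this]
  exact isVPFamily_detPoly_of_commRing k

/-- **`PER ∈ VP` over every field of characteristic two**, unconditionally: the hypothesis
`hdet : isVPFamily_detPoly k` of `isVPFamily_perPoly_of_charTwo` is the tree theorem
`isVPFamily_detPoly_holds k`. [cite: BurgisserClausenShokrollahi1997, Rem. (21.16)(1)] -/
theorem isVPFamily_perPoly_of_charTwo' (k : Type*) [Field k] [CharP k 2] :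
    IsVPFamily fun n => perPoly (Fin n) k :=
  isVPFamily_perPoly_of_charTwo k (isVPFamily_detPoly_holds k)

/-- **REFUTATION of the class form `CharacteristicFreePerNotVP`**: it is false that the permanent
family lies outside `VP` over every field, because over `𝔽₂ = ZMod 2` it lies inside `VP`
(`PER = DET` there, and `DET ∈ VP`). Hence the technique class is empty — no field-independent
argument concludes "`PER ∉ VP`" — and the named proposition admits no discharge
`CharacteristicFreePerNotVP_holds`. [cite: BurgisserClausenShokrollahi1997, Rem. (21.16)(1)] -/
theorem characteristicFreePerNotVP_false : ¬ CharacteristicFreePerNotVP :=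
  not_characteristicFreePerNotVP (isVPFamily_detPoly_holds (ZMod 2))

/-- Equivalently, in positive form: some field (namely `𝔽₂`) has its permanent family in `VP`.
[cite: BurgisserClausenShokrollahi1997, Rem. (21.16)(1)] -/
theorem exists_field_isVPFamily_perPoly :
    ∃ (k : Type) (_ : Field k), IsVPFamily fun n => perPoly (Fin n) k :=
  ⟨ZMod 2, inferInstance, isVPFamily_perPoly_of_charTwo' (ZMod 2)⟩

end Literature.Barriers.ValiantsHypothesis
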